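import Summits.QuantumFields.BalabanUV.T4Continuum.Spine.NE2.ConstantConnectionTower

/-!
# NE2 / AdjointRepresentationKernel — THE KERNEL OF BAŁABAN's `R(U) = Ad U` ON A COMPONENT FRAME IS THE CENTRE; THE gen-8 WITNESS TOWERS HAVE
# NON-TRIVIAL TIER-B TRANSPORTER DATA EXACTLY WHEN `X` IS NON-CENTRAL (cell `pub-balaban-gaps`, seat ne2, generation 9; row NE2 of `HOME/BALABAN-GAPS.md`)

HONEST FRAMING.  Row NE2 (node U1a of the T⁴ uniqueness spine: the η-rate of Bałaban's linear one-step objects) is NOT PRINTED and NOT PROVED; its class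
word is WORK-bound; nothing of Bałaban's is asserted beyond print; ONE finite torus; NOT ℝ⁴, NOT infinite volume, NOT a mass gap, NOT Clay.  This module is
[folklore] linear algebra about the TREE's model objects and changes no word.

WHAT IT SETTLES.  Generation 8 (`ConstantConnectionTower`, `ComposedRemainderCoherentTowerConstant`) showed that the END of record
`ComposedRemainderCoherentTowerSizes.composed_full_averaging_deltaPrime_rate_of_coherentTowers_top` is NON-VACUOUS on the constant-connection towers
`u_k^{(i)} ≡ exp(f(k,i)·X)` (`f = cph L` or `sph L`), `X` skew-hermitian and small, and recorded IN PROSE that for NON-CENTRAL `X` the tier-B transporter data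
`R = Ad(u_top)` of those towers are not the flat data.  Here that sentence becomes a kernel theorem, in the sharp form of an `iff`:
* §1 `adRep_eq_one_iff` — for a component frame `hF : CompFamily c P e` and a unitary `g`: `Ad g = 1` (the complexified component matrix `adRep hF g`) iff `R(g)`
  fixes the real subspace `P` pointwise (orthonormality + completeness + stability of the frame; `cpxHom` is injective);
* §2 `mem_range_scalar_of_forall_herm0` — a matrix commuting with every TRACELESS HERMITIAN matrix is SCALAR (remove the trace, split into hermitian parts,
  Mathlib's `Matrix.mem_range_scalar_of_commute_single`); hence (`adRep_eq_one_iff_mem_range_scalar`) on any frame whose subspace contains su(N)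
  (`herm0 n ≤ P` — the frame of record IS su(N), [B9] (3.3)) the kernel of `Ad` on `U(N)` is EXACTLY the centre (scalar unitaries);
* §3 `mlog_smul_one`, `eq_smul_one_of_exp_eq_smul_one` — (21) of a scalar matrix is scalar, so `‖Y‖ < ln 2 ∧ exp Y` scalar ⟹ `Y` scalar (`B7BlockAvgLog.mlog_exp`);
* §4 THE WITNESS TOWERS: `adRep_expUnit_eq_one_iff` (`Ad(exp Y) = 1 ↔ Y` scalar, for skew-hermitian `Y` with `‖Y‖ < ln 2`), and for the towers of
  generation 8 — `topAdT_cTow_eq_one_iff` / `topAdT_cTow_ne_one` (the tier-B transporter `Ad(u_k^{(k)})` at ANY bond of level `k` is `1` iff `X` is central,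
  whenever `0 < f(k,k) ≤ 1`), `connTower_cTow_ne_zero` (node NE3's connection reading `L^k(Ad u_k^{(k)} − 1)` is non-zero for non-central `X`), and
  `exists_noncentral_small` (for `N ≥ 2` colours non-central skew-hermitian `X` exist below every positive size threshold — so the open set of
  generation 8's `exists_nonflat_coherent_witness` contains data with NON-TRIVIAL adjoint transport); §6 `adRep_pauli_eq_one_iff` — for the β cell's
  su(2)∕Pauli frame (`P = herm0 (Fin 2)`) the frame hypothesis holds with equality (non-vacuity of `herm0 n ≤ P`).
NOT CLAIMED HERE: operator-level statements (this file is about the transporter DATA `Ad(u)`); the generation-9 companions settle two of them —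
`ComposedRemainderCoherentTowerNonTrivial` (the (124)-remainders `Erem` VANISH at these zero-curvature towers, for any transporter readings) and
`ConstantTransporterLaplacian` (the covariant-Laplacian summand `covPertC(Ad u)` of the tier-B perturbation is a NON-ZERO operator iff `X` is non-central);
whether the FULL operator of the END differs from the flat one is not claimed; nothing about Bałaban's minimiser.  Class word UNCHANGED: WORK-bound; NE2 NOT
proved; 0∕9.

Locators (shapes only): [B9] = Bałaban, CMP 99 (1985), (3.3) p. 390, (3.19) p. 393; [B7] = CMP 98 (1985), §A (21) p. 21.  All [folklore]; 0 sorry; axioms ⊆ the trio.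
-/

noncomputable section

open scoped BigOperators ComplexConjugate Matrix Matrix.Norms.L2Operator

namespace Summit.QuantumFields.BalabanUV.T4Continuum.NE2.AdjointRepresentationKernel

open Literature.MathematicalPhysics.QuantumFieldTheory.Balaban1983to89
open Literature.MathematicalPhysics.QuantumFieldTheory.Balaban1983to89.B9AdOrthogonal (R R_apply R_sum_smul form form_apply herm0 mem_herm0)
open Literature.MathematicalPhysics.QuantumFieldTheory.Balaban1983to89.MatrixLog (mlog hasSum_mlog)
open Literature.MathematicalPhysics.QuantumFieldTheory.Balaban1983to89.B7BlockAvgLog (mlog_exp)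
open Literature.MathematicalPhysics.QuantumFieldTheory.Balaban1983to89.B7Prop1Explicit (expUnit val_expUnit norm_exp_sub_one_le_of_norm_le)
open Literature.MathematicalPhysics.QuantumFieldTheory.Balaban1983to89.B5Prop11Plancherel (Tor fine)
open Literature.MathematicalPhysics.QuantumFieldTheory.Balaban1983to89.B5G183RateUnitTower (lev)
open Literature.Analysis.Complex (logSeriesCoeff)
open Summit.QuantumFields.BalabanUV.Beta.ThinLoopHolonomy (cpxHom cpxHom_apply)
open Summit.QuantumFields.BalabanUV.Beta.AdjointCarrierWiring (adMat adMat_apply)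
open Summit.QuantumFields.BalabanUV.Beta.AdjointCarrierWiringEnd (CompFamily)
open Summit.QuantumFields.BalabanUV.T4Continuum
open Summit.QuantumFields.BalabanUV.T4Continuum.BalabanAveragedTowerUnit (idx cast_lev')
open Summit.QuantumFields.BalabanUV.T4Continuum.RegularBackgroundTower (connTower connTower_eq)
open Summit.QuantumFields.BalabanUV.T4Continuum.NE2.AdjointFieldInstance (adRep adRep_apply)
open Summit.QuantumFields.BalabanUV.T4Continuum.NE2.ComposedRemainderGaugeTowerRegular (topAdT)
open Summit.QuantumFields.BalabanUV.T4Continuum.NE2.ComposedRemainderCoherentTower (liftU)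
open Summit.QuantumFields.BalabanUV.T4Continuum.NE2.ConstantConnectionTower (cTow cTow_val cTow_mem exp_smul_mem_unitaryGroup cph sph cph_of_le sph_top)

/-! ## §1 The kernel of `adRep`: `Ad g = 1` iff `R(g)` fixes the frame's subspace pointwise -/

section Kernel

variable {n : Type} [Fintype n] [DecidableEq n] {ι : Type} [Fintype ι] [DecidableEq ι]
variable {c : ℝ} {P : Submodule ℝ (Matrix n n ℂ)} {e : ι → Matrix n n ℂ} (hF : CompFamily c P e)

/-- the complexification of real component matrices is injective. [folklore] -/
theorem cpxHom_injective : Function.Injective (cpxHom (Cp := ι) : Matrix ι ι ℝ → Matrix ι ι ℂ) := by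
  intro A B h
  ext k i
  have hki : cpxHom A k i = cpxHom B k i := by rw [h]
  rw [cpxHom_apply, cpxHom_apply] at hki
  exact_mod_cast hki

/-- `Ad g = 1` forces the real component matrix to be `1`. [folklore] -/
theorem adMat_eq_one_of_adRep_eq_one {g : Matrix.unitaryGroup n ℂ} (h : adRep hF g = 1) : adMat c e (g : Matrix n n ℂ) = 1 :=
  cpxHom_injective (by rw [← adRep_apply, h, map_one])

/-- `Ad g = 1` ⟹ `R(g)` fixes every frame vector `e_i` (completeness of the frame on the `R(g)`-stable subspace `P`). [folklore] -/
theorem R_frame_eq_of_adRep_eq_one {g : Matrix.unitaryGroup n ℂ} (h : adRep hF g = 1) (i : ι) : R (g : Matrix n n ℂ) (e i) = e i := by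
  have hmem : R (g : Matrix n n ℂ) (e i) ∈ P := hF.stable _ g.2 _ (hF.mem i)
  have hA := adMat_eq_one_of_adRep_eq_one hF h
  rw [← hF.compl _ hmem]
  calc ∑ k, form c (e k) (R (g : Matrix n n ℂ) (e i)) • e k = ∑ k, (1 : Matrix ι ι ℝ) k i • e k := by
        refine Finset.sum_congr rfl fun k _ => ?_
        rw [← adMat_apply, hA]
    _ = e i := by
        rw [Finset.sum_eq_single i (fun k _ hk => by rw [Matrix.one_apply_ne hk, zero_smul])
          (fun hi => (hi (Finset.mem_univ i)).elim), Matrix.one_apply_eq, one_smul]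

/-- **`Ad g = 1` ⟹ `R(g)X = X` FOR EVERY `X ∈ P`.** [cite: Balaban1985BackgroundPropagators, (3.3) p.390 (shape)] [folklore] -/
theorem R_eq_self_of_adRep_eq_one {g : Matrix.unitaryGroup n ℂ} (h : adRep hF g = 1) {X : Matrix n n ℂ} (hX : X ∈ P) :
    R (g : Matrix n n ℂ) X = X := by
  conv_lhs => rw [← hF.compl X hX]
  conv_rhs => rw [← hF.compl X hX]
  rw [R_sum_smul]
  exact Finset.sum_congr rfl fun i _ => by rw [R_frame_eq_of_adRep_eq_one hF h i]

/-- **`R(g)X = X` FOR EVERY `X ∈ P` ⟹ `Ad g = 1`** (orthonormality of the frame). [folklore] -/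
theorem adRep_eq_one_of_R_eq_self {g : Matrix.unitaryGroup n ℂ} (h : ∀ X ∈ P, R (g : Matrix n n ℂ) X = X) : adRep hF g = 1 := by
  have hA : adMat c e (g : Matrix n n ℂ) = 1 := by
    ext k i
    rw [adMat_apply, h _ (hF.mem i), hF.orth, Matrix.one_apply]
  rw [adRep_apply, hA, map_one]

/-- **THE KERNEL OF `adRep`**: `Ad g = 1 ↔ R(g)` fixes `P` pointwise. [folklore] -/
theorem adRep_eq_one_iff (g : Matrix.unitaryGroup n ℂ) : adRep hF g = 1 ↔ ∀ X ∈ P, R (g : Matrix n n ℂ) X = X :=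
  ⟨fun h _ hX => R_eq_self_of_adRep_eq_one hF h hX, adRep_eq_one_of_R_eq_self hF⟩

end Kernel

/-! ## §2 A matrix commuting with su(N) is scalar; the kernel of `Ad` on a frame containing su(N) is the centre -/

section Centre

variable {n : Type} [Fintype n] [DecidableEq n]

/-- `R(g)X = X` with `g` invertible means `gX = Xg`. [folklore] -/
theorem mul_eq_mul_of_R_eq {g X : Matrix n n ℂ} (hg : IsUnit g.det) (h : R g X = X) : g * X = X * g := by
  calc g * X = g * X * (g⁻¹ * g) := by rw [Matrix.nonsing_inv_mul _ hg, Matrix.mul_one]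
    _ = R g X * g := by rw [B9AdOrthogonal.R_apply, ← Matrix.mul_assoc]
    _ = X * g := by rw [h]

/-- **A MATRIX COMMUTING WITH EVERY TRACELESS HERMITIAN MATRIX COMMUTES WITH EVERY MATRIX** (`A = A₀ + (tr A∕N)·1`, `A₀ = ½(A₀ + A₀ᴴ) + (i∕2)(iA₀ᴴ + (iA₀ᴴ)ᴴ)`,
both brackets traceless hermitian). [folklore] -/
theorem commute_of_forall_herm0 [Nonempty n] {g : Matrix n n ℂ} (h : ∀ X ∈ herm0 n, g * X = X * g) (A : Matrix n n ℂ) : g * A = A * g := by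
  set N : ℂ := (Fintype.card n : ℂ) with hNdef
  have hN : N ≠ 0 := Nat.cast_ne_zero.mpr Fintype.card_ne_zero
  set A₀ : Matrix n n ℂ := A - (A.trace / N) • (1 : Matrix n n ℂ) with hA₀
  have htr : A₀.trace = 0 := by
    rw [hA₀, Matrix.trace_sub, Matrix.trace_smul, Matrix.trace_one, smul_eq_mul, ← hNdef, div_mul_cancel₀ _ hN, sub_self]
  set H₁ : Matrix n n ℂ := A₀ + A₀ᴴ with hH₁def
  set H₂ : Matrix n n ℂ := Complex.I • A₀ᴴ + (Complex.I • A₀ᴴ)ᴴ with hH₂def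
  have hH₁ : H₁ ∈ herm0 n :=
    ⟨Matrix.isHermitian_add_transpose_self A₀, by rw [hH₁def, Matrix.trace_add, Matrix.trace_conjTranspose, htr, star_zero, add_zero]⟩
  have hH₂ : H₂ ∈ herm0 n :=
    ⟨Matrix.isHermitian_add_transpose_self _, by
      rw [hH₂def, Matrix.trace_add, Matrix.trace_conjTranspose, Matrix.trace_smul, Matrix.trace_conjTranspose, htr, star_zero, smul_zero,
        star_zero, add_zero]⟩
  have hI1 : (Complex.I / 2) * Complex.I = -(1 / 2 : ℂ) := by rw [div_mul_eq_mul_div, Complex.I_mul_I]; ring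
  have hI2 : (Complex.I / 2) * (-Complex.I) = (1 / 2 : ℂ) := by rw [mul_neg, div_mul_eq_mul_div, Complex.I_mul_I]; ring
  have hdec : A₀ = (1 / 2 : ℂ) • H₁ + (Complex.I / 2) • H₂ := by
    rw [hH₁def, hH₂def, Matrix.conjTranspose_smul, Matrix.conjTranspose_conjTranspose, Complex.star_def, Complex.conj_I, smul_add, smul_add,
      smul_smul, smul_smul, hI1, hI2]
    module
  have hA₀c : g * A₀ = A₀ * g := by
    rw [hdec, Matrix.mul_add, Matrix.add_mul, Matrix.mul_smul, Matrix.mul_smul, Matrix.smul_mul, Matrix.smul_mul, h _ hH₁, h _ hH₂]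
  have hA : A = A₀ + (A.trace / N) • (1 : Matrix n n ℂ) := by rw [hA₀, sub_add_cancel]
  rw [hA, Matrix.mul_add, Matrix.add_mul, hA₀c, Matrix.mul_smul, Matrix.smul_mul, Matrix.mul_one, Matrix.one_mul]

/-- **… HENCE IS A SCALAR MATRIX** (Mathlib's `Matrix.mem_range_scalar_of_commute_single`). [folklore] -/
theorem mem_range_scalar_of_forall_herm0 [Nonempty n] {g : Matrix n n ℂ} (h : ∀ X ∈ herm0 n, g * X = X * g) :
    g ∈ Set.range (Matrix.scalar n) :=
  Matrix.mem_range_scalar_of_commute_single fun i j _ => (commute_of_forall_herm0 h (Matrix.single i j 1)).symm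

/-- membership in the range of `Matrix.scalar` as `∃ z, g = z·1`. [folklore] -/
theorem mem_range_scalar_iff_exists_smul_one (g : Matrix n n ℂ) : g ∈ Set.range (Matrix.scalar n) ↔ ∃ z : ℂ, g = z • (1 : Matrix n n ℂ) :=
  ⟨fun ⟨z, hz⟩ => ⟨z, by rw [← hz, Matrix.scalar_apply, Matrix.smul_one_eq_diagonal]⟩,
    fun ⟨z, hz⟩ => ⟨z, by rw [hz, Matrix.scalar_apply, Matrix.smul_one_eq_diagonal]⟩⟩

/-- `R(z·1) = id` for a unit scalar: a central unitary acts trivially. [folklore] -/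
theorem R_smul_one_eq {z : ℂ} (hz : z ≠ 0) (X : Matrix n n ℂ) : R (z • (1 : Matrix n n ℂ)) X = X := by
  have hinv : (z • (1 : Matrix n n ℂ))⁻¹ = z⁻¹ • (1 : Matrix n n ℂ) := by
    refine Matrix.inv_eq_left_inv ?_
    rw [smul_mul_smul_comm, inv_mul_cancel₀ hz, Matrix.one_mul, one_smul]
  rw [B9AdOrthogonal.R_apply, hinv, Matrix.smul_mul, Matrix.one_mul, Matrix.mul_smul, Matrix.mul_one, smul_smul, inv_mul_cancel₀ hz, one_smul]

variable {ι : Type} [Fintype ι] [DecidableEq ι] {c : ℝ} {P : Submodule ℝ (Matrix n n ℂ)} {e : ι → Matrix n n ℂ} (hF : CompFamily c P e)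

/-- a unitary has non-zero entries of modulus data: a scalar unitary `z·1` has `z ≠ 0`. [folklore] -/
theorem ne_zero_of_smul_one_mem_unitaryGroup [Nonempty n] {z : ℂ} (hz : z • (1 : Matrix n n ℂ) ∈ Matrix.unitaryGroup n ℂ) : z ≠ 0 := by
  rintro rfl
  have h := Matrix.mem_unitaryGroup_iff.mp hz
  rw [zero_smul, Matrix.zero_mul] at h
  obtain ⟨i⟩ := ‹Nonempty n›
  have hi := congrFun (congrFun h i) i
  rw [Matrix.zero_apply, Matrix.one_apply_eq] at hi
  exact zero_ne_one hi

/-- **A CENTRAL UNITARY HAS `Ad = 1`** (any frame). [folklore] -/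
theorem adRep_eq_one_of_mem_range_scalar [Nonempty n] {g : Matrix.unitaryGroup n ℂ} (hg : (g : Matrix n n ℂ) ∈ Set.range (Matrix.scalar n)) :
    adRep hF g = 1 := by
  obtain ⟨z, hz⟩ := (mem_range_scalar_iff_exists_smul_one _).mp hg
  have hz0 : z ≠ 0 := ne_zero_of_smul_one_mem_unitaryGroup (n := n) (by rw [← hz]; exact g.2)
  exact adRep_eq_one_of_R_eq_self hF fun X _ => by rw [hz, R_smul_one_eq hz0]

/-- **THE KERNEL OF `Ad` ON A FRAME CONTAINING su(N) IS THE CENTRE**: for `herm0 n ≤ P` (every traceless hermitian matrix lies in the frame's subspace — e.g.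
`P = herm0 n` itself, the β cell's su(2)∕Pauli frame `compFamily_pauli`), `Ad g = 1 ↔ g` is a scalar unitary. [cite: Balaban1985BackgroundPropagators, (3.3) p.390 (shape)] [folklore] -/
theorem adRep_eq_one_iff_mem_range_scalar [Nonempty n] (hP : herm0 n ≤ P) (g : Matrix.unitaryGroup n ℂ) :
    adRep hF g = 1 ↔ (g : Matrix n n ℂ) ∈ Set.range (Matrix.scalar n) := by
  refine ⟨fun h => mem_range_scalar_of_forall_herm0 fun X hX => ?_, adRep_eq_one_of_mem_range_scalar hF⟩
  exact mul_eq_mul_of_R_eq (Literature.MathematicalPhysics.QuantumLattice.isUnit_det_of_mem_unitaryGroup g.2)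
    (R_eq_self_of_adRep_eq_one hF h (hP hX))

end Centre

/-! ## §3 Bałaban's logarithm of a scalar matrix is scalar; small matrices with scalar exponential are scalar -/

section ScalarLog

variable {n : Type} [Fintype n] [DecidableEq n] [Nonempty n]

omit [Fintype n] [Nonempty n] in
/-- `z·1 − 1 = (z − 1)·1`. [folklore] -/
theorem smul_one_sub_one (z : ℂ) : z • (1 : Matrix n n ℂ) - 1 = (z - 1) • (1 : Matrix n n ℂ) := by rw [sub_smul, one_smul]

/-- **`log(z·1) = (log z)·1`** for `|z − 1| < 1` — the series (21) summed in `ℂ` and in `M_N(ℂ)` have proportional terms. [cite: Balaban1985Averaging, (21) p.21 (shape)] [folklore] -/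
theorem mlog_smul_one {z : ℂ} (hz : ‖z - 1‖ < 1) : mlog (z • (1 : Matrix n n ℂ)) = (mlog z) • (1 : Matrix n n ℂ) := by
  have h1 : HasSum (fun m : ℕ => (logSeriesCoeff m • (z - 1) ^ m) • (1 : Matrix n n ℂ)) ((mlog z) • (1 : Matrix n n ℂ)) :=
    (hasSum_mlog hz).smul_const _
  have hz' : ‖z • (1 : Matrix n n ℂ) - 1‖ < 1 := by rwa [smul_one_sub_one, norm_smul, norm_one, mul_one]
  have h2 : HasSum (fun m : ℕ => logSeriesCoeff m • (z • (1 : Matrix n n ℂ) - 1) ^ m) (mlog (z • (1 : Matrix n n ℂ))) := hasSum_mlog hz'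
  have heq : (fun m : ℕ => logSeriesCoeff m • (z • (1 : Matrix n n ℂ) - 1) ^ m) = fun m : ℕ => (logSeriesCoeff m • (z - 1) ^ m) • (1 : Matrix n n ℂ) := by
    funext m
    rw [smul_one_sub_one, smul_pow, one_pow, smul_assoc]
  rw [heq] at h2
  exact h2.unique h1

/-- **A SMALL MATRIX WITH SCALAR EXPONENTIAL IS SCALAR**: `‖Y‖ < ln 2` and `exp Y = z·1` ⟹ `Y = (log z)·1` (`Y = log(exp Y)` by `B7BlockAvgLog.mlog_exp`, and
`|z − 1| = ‖exp Y − 1‖ ≤ e^{‖Y‖} − 1 < 1`). [folklore] -/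
theorem eq_smul_one_of_exp_eq_smul_one {Y : Matrix n n ℂ} (hY : ‖Y‖ < Real.log 2) {z : ℂ} (h : NormedSpace.exp Y = z • (1 : Matrix n n ℂ)) :
    Y = (mlog z) • (1 : Matrix n n ℂ) := by
  have hz : ‖z - 1‖ < 1 := by
    have h1 : ‖NormedSpace.exp Y - 1‖ ≤ Real.exp ‖Y‖ - 1 := (norm_exp_sub_one_le_of_norm_le le_rfl).1
    have h2 : Real.exp ‖Y‖ < 2 := by
      calc Real.exp ‖Y‖ < Real.exp (Real.log 2) := Real.exp_lt_exp.mpr hY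
        _ = 2 := Real.exp_log (by norm_num)
    rw [h, smul_one_sub_one, norm_smul, norm_one, mul_one] at h1
    linarith
  rw [← mlog_smul_one hz, ← h, mlog_exp hY]

/-- … as a membership statement: `exp Y` scalar ⟹ `Y` scalar (`‖Y‖ < ln 2`). [folklore] -/
theorem mem_range_scalar_of_exp_mem {Y : Matrix n n ℂ} (hY : ‖Y‖ < Real.log 2) (h : NormedSpace.exp Y ∈ Set.range (Matrix.scalar n)) :
    Y ∈ Set.range (Matrix.scalar n) := by
  obtain ⟨z, hz⟩ := (mem_range_scalar_iff_exists_smul_one _).mp h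
  exact (mem_range_scalar_iff_exists_smul_one _).mpr ⟨mlog z, eq_smul_one_of_exp_eq_smul_one hY hz⟩

omit [Nonempty n] in
/-- conversely `exp(z·1) = e^z·1` is scalar. [folklore] -/
theorem exp_smul_one_mem_range_scalar {Y : Matrix n n ℂ} (h : Y ∈ Set.range (Matrix.scalar n)) : NormedSpace.exp Y ∈ Set.range (Matrix.scalar n) := by
  obtain ⟨z, hz⟩ := (mem_range_scalar_iff_exists_smul_one _).mp h
  refine (mem_range_scalar_iff_exists_smul_one _).mpr ⟨Complex.exp z, ?_⟩
  rw [hz, ← Algebra.algebraMap_eq_smul_one, ← Algebra.algebraMap_eq_smul_one, Complex.exp_eq_exp_ℂ]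
  exact (NormedSpace.algebraMap_exp_comm (𝔸 := Matrix n n ℂ) z).symm

end ScalarLog

/-! ## §4 `Ad(exp Y)` is trivial iff `Y` is central; the generation-8 witness towers have non-trivial tier-B transporters for non-central `X` -/

section Witness

variable {n : Type} [Fintype n] [DecidableEq n] [Nonempty n] {ι : Type} [Fintype ι] [DecidableEq ι]
variable {c : ℝ} {P : Submodule ℝ (Matrix n n ℂ)} {e : ι → Matrix n n ℂ} (hF : CompFamily c P e)

/-- **`Ad(exp Y) = 1 ↔ Y` IS CENTRAL**, for `Y` with `exp Y` unitary, `‖Y‖ < ln 2`, on a frame containing su(N). [folklore] -/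
theorem adRep_exp_eq_one_iff (hP : herm0 n ≤ P) {Y : Matrix n n ℂ} (hYu : NormedSpace.exp Y ∈ Matrix.unitaryGroup n ℂ) (hY : ‖Y‖ < Real.log 2) :
    adRep hF ⟨NormedSpace.exp Y, hYu⟩ = 1 ↔ Y ∈ Set.range (Matrix.scalar n) := by
  rw [adRep_eq_one_iff_mem_range_scalar hF hP]
  exact ⟨mem_range_scalar_of_exp_mem hY, exp_smul_one_mem_range_scalar⟩

omit [Nonempty n] in
/-- a real multiple `r·X`, `r ≠ 0`, is central iff `X` is. [folklore] -/
theorem real_smul_mem_range_scalar_iff {r : ℝ} (hr : r ≠ 0) (X : Matrix n n ℂ) :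
    ((r : ℂ) • X) ∈ Set.range (Matrix.scalar n) ↔ X ∈ Set.range (Matrix.scalar n) := by
  have hr' : (r : ℂ) ≠ 0 := Complex.ofReal_ne_zero.mpr hr
  rw [mem_range_scalar_iff_exists_smul_one, mem_range_scalar_iff_exists_smul_one]
  constructor
  · rintro ⟨z, hz⟩
    refine ⟨(r : ℂ)⁻¹ * z, ?_⟩
    rw [mul_smul, ← hz, smul_smul, inv_mul_cancel₀ hr', one_smul]
  · rintro ⟨z, rfl⟩
    exact ⟨(r : ℂ) * z, by rw [smul_smul]⟩

/-- **THE TIER-B TRANSPORTER OF A CONSTANT-PER-LEVEL TOWER AT ITS TOP LEVEL**, `Ad(u_k^{(k)}) = Ad(exp(f(k,k)·X))`, IS `1` AT A BOND IFF `X` IS CENTRAL —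
for skew-hermitian `X`, a phase `0 < f(k,k) ≤ 1` and `‖X‖ < ln 2`, on a frame containing su(N). [folklore] -/
theorem topAdT_cTow_eq_one_iff {d : ℕ} (L : ℕ) [NeZero L] (M : Fin d → ℕ) [∀ μ, NeZero (M μ)] (hP : herm0 n ≤ P) {f : ℕ → ℕ → ℝ} {X : Matrix n n ℂ}
    (hX : star X = -X) (hXs : ‖X‖ < Real.log 2) {k : ℕ} (hf0 : 0 < f k k) (hf1 : f k k ≤ 1) (ν : Fin d) (b : idx L M k) :
    topAdT L M hF (liftU L M (cTow L M f X) (cTow_mem L M f hX)) k ν b = 1 ↔ X ∈ Set.range (Matrix.scalar n) := by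
  have hYs : ‖((f k k : ℝ) : ℂ) • X‖ < Real.log 2 := by
    rw [norm_smul, Complex.norm_real, Real.norm_eq_abs, abs_of_nonneg hf0.le]
    exact lt_of_le_of_lt (mul_le_of_le_one_left (norm_nonneg X) hf1) hXs
  show adRep hF ⟨NormedSpace.exp (((f k k : ℝ) : ℂ) • X), exp_smul_mem_unitaryGroup hX _⟩ = 1 ↔ _
  rw [adRep_exp_eq_one_iff hF hP _ hYs, real_smul_mem_range_scalar_iff hf0.ne']

/-- **NON-TRIVIAL TIER-B DATA OF THE WITNESS TOWERS**: for NON-CENTRAL skew-hermitian `X` with `‖X‖ < ln 2` and a phase `0 < f(k,k) ≤ 1` the transporter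
`Ad(u_k^{(k)})` differs from `1` at EVERY bond of level `k`. [folklore] -/
theorem topAdT_cTow_ne_one {d : ℕ} (L : ℕ) [NeZero L] (M : Fin d → ℕ) [∀ μ, NeZero (M μ)] (hP : herm0 n ≤ P) {f : ℕ → ℕ → ℝ} {X : Matrix n n ℂ}
    (hX : star X = -X) (hXs : ‖X‖ < Real.log 2) (hXc : X ∉ Set.range (Matrix.scalar n)) {k : ℕ} (hf0 : 0 < f k k) (hf1 : f k k ≤ 1) (ν : Fin d)
    (b : idx L M k) : topAdT L M hF (liftU L M (cTow L M f X) (cTow_mem L M f hX)) k ν b ≠ 1 :=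
  fun h => hXc ((topAdT_cTow_eq_one_iff hF L M hP hX hXs hf0 hf1 ν b).mp h)

/-- **NODE NE3's CONNECTION READING IS NON-ZERO** at such data: `L^k(Ad(u_k^{(k)}) − 1) ≠ 0`. [folklore] -/
theorem connTower_cTow_ne_zero {d : ℕ} (L : ℕ) [NeZero L] (M : Fin d → ℕ) [∀ μ, NeZero (M μ)] (hP : herm0 n ≤ P) {f : ℕ → ℕ → ℝ} {X : Matrix n n ℂ}
    (hX : star X = -X) (hXs : ‖X‖ < Real.log 2) (hXc : X ∉ Set.range (Matrix.scalar n)) {k : ℕ} (hf0 : 0 < f k k) (hf1 : f k k ≤ 1) (ν : Fin d)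
    (b : idx L M k) : connTower L M (topAdT L M hF (liftU L M (cTow L M f X) (cTow_mem L M f hX))) k ν b ≠ 0 := by
  rw [connTower_eq, smul_ne_zero_iff]
  refine ⟨?_, sub_ne_zero.mpr (topAdT_cTow_ne_one hF L M hP hX hXs hXc hf0 hf1 ν b)⟩
  exact Nat.cast_ne_zero.mpr (NeZero.ne (lev L k))

/-- the constant-connection tower (`f = cph L`, top phase `L^{−2k}`) and the stationary tower (`f = sph L`, top phase `L^{−k}`): both top phases lie in `(0, 1]`. [folklore] -/
theorem cph_sph_top_pos_le_one (L : ℕ) [NeZero L] (k : ℕ) : (0 < cph L k k ∧ cph L k k ≤ 1) ∧ (0 < sph L k k ∧ sph L k k ≤ 1) := by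
  have hL : (1 : ℝ) ≤ L := by exact_mod_cast Nat.one_le_iff_ne_zero.mpr (NeZero.ne L)
  rw [cph_of_le L le_rfl, sph_top]
  exact ⟨⟨by positivity, inv_le_one_of_one_le₀ (one_le_pow₀ hL)⟩, ⟨by positivity, inv_le_one_of_one_le₀ (one_le_pow₀ hL)⟩⟩

/-- **FOR THE TWO WITNESS TOWERS OF RECORD** (`f = cph L` or `f = sph L`): at every level `k`, direction `ν` and bond `b` the tier-B transporter `Ad(u_k^{(k)})`
is `≠ 1` and the NE3 connection reading is `≠ 0`, for every NON-CENTRAL skew-hermitian `X` with `‖X‖ < ln 2` (the open set `‖X‖e^{‖X‖} < t₀ ≤ 1∕16` of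
`ComposedRemainderCoherentTowerConstant.exists_nonflat_coherent_witness` lies inside `‖X‖ < ln 2`). [folklore] -/
theorem witness_towers_nontrivial {d : ℕ} (L : ℕ) [NeZero L] (M : Fin d → ℕ) [∀ μ, NeZero (M μ)] (hP : herm0 n ≤ P) {X : Matrix n n ℂ} (hX : star X = -X)
    (hXs : ‖X‖ < Real.log 2) (hXc : X ∉ Set.range (Matrix.scalar n)) {f : ℕ → ℕ → ℝ} (hf : f = cph L ∨ f = sph L) (k : ℕ) (ν : Fin d) (b : idx L M k) :
    topAdT L M hF (liftU L M (cTow L M f X) (cTow_mem L M f hX)) k ν b ≠ 1 ∧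
      connTower L M (topAdT L M hF (liftU L M (cTow L M f X) (cTow_mem L M f hX))) k ν b ≠ 0 := by
  have hk := cph_sph_top_pos_le_one L k
  rcases hf with rfl | rfl
  · exact ⟨topAdT_cTow_ne_one hF L M hP hX hXs hXc hk.1.1 hk.1.2 ν b, connTower_cTow_ne_zero hF L M hP hX hXs hXc hk.1.1 hk.1.2 ν b⟩
  · exact ⟨topAdT_cTow_ne_one hF L M hP hX hXs hXc hk.2.1 hk.2.2 ν b, connTower_cTow_ne_zero hF L M hP hX hXs hXc hk.2.1 hk.2.2 ν b⟩

end Witness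

/-! ## §5 Non-central small skew-hermitian matrices exist for `N ≥ 2` colours -/

section Existence

variable {n : Type} [Fintype n] [DecidableEq n]

omit [Fintype n] in
/-- `i·E_{aa}` is skew-hermitian. [folklore] -/
theorem star_I_smul_single (a : n) : star (Complex.I • Matrix.single a a (1 : ℂ)) = -(Complex.I • Matrix.single a a (1 : ℂ)) := by
  rw [Matrix.star_eq_conjTranspose, Matrix.conjTranspose_smul, Matrix.conjTranspose_single, star_one, Complex.star_def, Complex.conj_I, neg_smul]

/-- `i·E_{aa}` is NOT central when there is a second index `b ≠ a`. [folklore] -/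
theorem I_smul_single_not_mem_range_scalar {a b : n} (hab : a ≠ b) {r : ℝ} (hr : r ≠ 0) :
    ((r : ℂ) • (Complex.I • Matrix.single a a (1 : ℂ))) ∉ Set.range (Matrix.scalar n) := by
  rw [mem_range_scalar_iff_exists_smul_one]
  rintro ⟨z, hz⟩
  have ha := congrFun (congrFun hz a) a
  have hb := congrFun (congrFun hz b) b
  have hbb : Matrix.single a a (1 : ℂ) b b = 0 := Matrix.single_apply_of_ne _ _ _ _ _ fun h => hab h.1
  simp only [Matrix.smul_apply, Matrix.single_apply_same, Matrix.one_apply_eq, smul_eq_mul, mul_one, hbb, mul_zero] at ha hb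
  rw [← hb, mul_eq_zero] at ha
  rcases ha with ha | ha
  · exact hr (Complex.ofReal_eq_zero.mp ha)
  · exact Complex.I_ne_zero ha

/-- **NON-CENTRAL SKEW-HERMITIAN MATRICES OF ARBITRARILY SMALL SIZE EXIST** when there are at least two colour indices: for every `t₀ > 0` some skew-hermitian
non-central `X` has `‖X‖ < ln 2` and `‖X‖e^{‖X‖} < t₀` — so generation 8's open set of admissible `X` contains data with non-trivial adjoint transport. [folklore] -/
theorem exists_noncentral_small [Nontrivial n] {t₀ : ℝ} (ht₀ : 0 < t₀) :
    ∃ X : Matrix n n ℂ, star X = -X ∧ X ∉ Set.range (Matrix.scalar n) ∧ ‖X‖ < Real.log 2 ∧ ‖X‖ * Real.exp ‖X‖ < t₀ := by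
  obtain ⟨a, b, hab⟩ := exists_pair_ne n
  set E : Matrix n n ℂ := Complex.I • Matrix.single a a (1 : ℂ) with hE
  set s : ℝ := min (1 / 2) (t₀ / 4) with hs
  have hs0 : 0 < s := lt_min (by norm_num) (by linarith)
  have hs1 : s ≤ 1 / 2 := min_le_left _ _
  have hs2 : s ≤ t₀ / 4 := min_le_right _ _
  set r : ℝ := s / (‖E‖ + 1) with hr
  have hE0 : 0 < ‖E‖ + 1 := by positivity
  have hr0 : 0 < r := div_pos hs0 hE0
  refine ⟨(r : ℂ) • E, ?_, I_smul_single_not_mem_range_scalar hab hr0.ne', ?_, ?_⟩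
  · rw [star_smul, Complex.star_def, Complex.conj_ofReal, hE, star_I_smul_single, smul_neg]
  · have hn : ‖((r : ℂ) • E)‖ ≤ s := by
      rw [norm_smul, Complex.norm_real, Real.norm_eq_abs, abs_of_nonneg hr0.le, hr, div_mul_eq_mul_div, div_le_iff₀ hE0]
      nlinarith [norm_nonneg E]
    have hlog : (1 : ℝ) / 2 < Real.log 2 := by
      rw [Real.lt_log_iff_exp_lt (by norm_num)]
      have hsq : Real.exp (1 / 2 : ℝ) * Real.exp (1 / 2 : ℝ) = Real.exp 1 := by rw [← Real.exp_add]; norm_num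
      nlinarith [Real.exp_one_lt_d9, Real.exp_pos (1 / 2 : ℝ)]
    linarith
  · have hn : ‖((r : ℂ) • E)‖ ≤ s := by
      rw [norm_smul, Complex.norm_real, Real.norm_eq_abs, abs_of_nonneg hr0.le, hr, div_mul_eq_mul_div, div_le_iff₀ hE0]
      nlinarith [norm_nonneg E]
    have hexp : Real.exp ‖((r : ℂ) • E)‖ ≤ 3 := by
      calc Real.exp ‖((r : ℂ) • E)‖ ≤ Real.exp (1 : ℝ) := Real.exp_le_exp.mpr (by linarith)
        _ ≤ 3 := by have := Real.exp_one_lt_d9; linarith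
    calc ‖((r : ℂ) • E)‖ * Real.exp ‖((r : ℂ) • E)‖ ≤ s * 3 := mul_le_mul hn hexp (Real.exp_pos _).le hs0.le
      _ < t₀ := by linarith

end Existence

/-! ## §6 The frame of record: for the β cell's su(2)∕Pauli frame the hypothesis `herm0 n ≤ P` holds with equality -/

section Pauli

open Summit.QuantumFields.BalabanUV.Beta.AdjointCarrierWiringEnd (compFamily_pauli)

/-- **NON-VACUITY OF THE FRAME HYPOTHESIS**: for the su(2)∕Pauli component frame `compFamily_pauli` (`P = herm0 (Fin 2)`) the kernel of `Ad` on `U(2)` is the centre,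
with no hypothesis left. [folklore] -/
theorem adRep_pauli_eq_one_iff (g : Matrix.unitaryGroup (Fin 2) ℂ) :
    adRep compFamily_pauli g = 1 ↔ (g : Matrix (Fin 2) (Fin 2) ℂ) ∈ Set.range (Matrix.scalar (Fin 2)) :=
  adRep_eq_one_iff_mem_range_scalar compFamily_pauli le_rfl g

end Pauli

end Summit.QuantumFields.BalabanUV.T4Continuum.NE2.AdjointRepresentationKernel

end
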